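import Summits.MatrixMultiplication.MatrixMultiplication.Theorems.SaturationLadderTwinRung
import Summits.MatrixMultiplication.MatrixMultiplication.Theorems.SaturationLadderTwinSaturation
import Literature.Computability.AlgebraicComplexity.RectangularExponentSubadditivity
import Literature.Computability.AlgebraicComplexity.RectangularExponentInformationBound
import HarnessLib

/-!
# SaturationLadder — the saturation THRESHOLD form of the twin rung

Route `SaturationLadder` (sub-problem `MatrixMultiplication`).  `TwinSaturation`
(`Theorems/SaturationLadderTwinSaturation.lean`, proved) produces, for every `t ∈ [0,1)`, SOME
`r ≤ C · 3^{1/(1−t)}` with `ω(1,t,r) = 1 + r`.  By Lotti–Romani subadditivity in the third slot,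
`ω(1,t,r+s) ≤ ω(1,t,r) + s`, saturation persists to the right, so the statement upgrades to a THRESHOLD:

* `omegaRect_one_eq_of_saturated_le`: `ω(1,t,r) ≤ 1 + r`, `r ≤ r'` ⟹ `ω(1,t,r') = 1 + r'`.
* `twinSaturation_threshold`: **`∃ C, ∀ t ∈ [0,1), ∀ r ≥ C · 3^{1/(1−t)}, ω(1, t, r) = 1 + r`** — the
  information bound `ω(1,t,r) ≥ 1 + r` (Huang–Pan (2.8)) is an equality from `C · 3^{1/(1−t)}` on, for every
  `t < 1` (Coppersmith–Winograd's level-1 analysis gives this from `16 · 4^{1/(1−t)}` on).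
* `saturation_threshold_above_log_three`: for every `c > log 3`, eventually in `t`, equality holds for all
  `r ≥ e^{c/(1−t)}` — the current rung of the quantitative ladder towards `SubexpSaturation`
  (stmt-MatrixMultiplication-25909: the same for every `c > 0`).

No named facts, no sorry (cell `decomp-mm`, lens 1, gen 8).
-/

set_option linter.dupNamespace false
-- (single-conjunct summit: the namespace repeats `MatrixMultiplication`)

noncomputable section

namespace Summit.MatrixMultiplication.MatrixMultiplication.Theorems.SaturationLadderTwinThreshold

open Literature.Computability.AlgebraicComplexity
open Summit.MatrixMultiplication.MatrixMultiplication.Theorems.SaturationLadderTwinSaturation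
  (twinSaturation)
open Summit.MatrixMultiplication.MatrixMultiplication.Theorems.SaturationLadderTwinRung
  (subexpSaturation_clause_of_twinSaturation)

/-- Saturation persists to the right: `ω(1,t,r) ≤ 1 + r` and `r ≤ r'` give `ω(1,t,r') = 1 + r'`
(subadditivity `ω(1,t,r+s) ≤ ω(1,t,r) + s` and the information bound `1 + r' ≤ ω(1,t,r')`).
[cite: LottiRomani1983, §1 (p. 173)] [cite: HuangPan1998, (2.8)] -/
theorem omegaRect_one_eq_of_saturated_le {t r r' : ℝ} (h : omegaRect ℂ 1 t r ≤ 1 + r)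
    (hr : r ≤ r') : omegaRect ℂ 1 t r' = 1 + r' := by
  have h1 := omegaRect_add_le_add_pos ℂ 1 t r 0 0 (r' - r)
  rw [add_zero, add_zero, show r + (r' - r) = r' by ring, max_self,
    max_eq_left (by linarith : (0 : ℝ) ≤ r' - r)] at h1
  exact le_antisymm (by linarith) (add_le_omegaRect₁₃ ℂ 1 t r')

/-- **Twin saturation threshold**: `∃ C, ∀ t ∈ [0,1), ∀ r ≥ C · 3^{1/(1−t)}, ω(1, t, r) = 1 + r`.
[cite: CoppersmithWinograd1990, §8] [cite: AlmanDuanVassilevskaWilliamsXuXuZhou2025, Thm. 3.2, §3.4] -/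
theorem twinSaturation_threshold :
    ∃ C : ℝ, ∀ t : ℝ, 0 ≤ t → t < 1 → ∀ r : ℝ, C * (3 : ℝ) ^ (1 / (1 - t)) ≤ r →
      omegaRect ℂ 1 t r = 1 + r := by
  obtain ⟨C, H⟩ := twinSaturation
  refine ⟨C, fun t ht0 ht1 r hr => ?_⟩
  obtain ⟨r₀, -, hr₀, hω⟩ := H t ht0 ht1
  exact omegaRect_one_eq_of_saturated_le hω (hr₀.trans hr)

/-- **The threshold for every `c > log 3`, eventually in `t`**: `∃ t₀ < 1, ∀ t ∈ [t₀,1), ∀ r ≥ e^{c/(1−t)},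
ω(1, t, r) = 1 + r`. [cite: CoppersmithWinograd1990, §8] [cite: HuangPan1998, (2.8)] -/
theorem saturation_threshold_above_log_three (c : ℝ) (hc : Real.log 3 < c) :
    ∃ t₀ : ℝ, t₀ < 1 ∧ ∀ t : ℝ, t₀ ≤ t → t < 1 → ∀ r : ℝ, Real.exp (c / (1 - t)) ≤ r →
      omegaRect ℂ 1 t r = 1 + r := by
  obtain ⟨t₀, ht₀, H⟩ := subexpSaturation_clause_of_twinSaturation twinSaturation c hc
  refine ⟨t₀, ht₀, fun t ht ht1 r hr => ?_⟩
  obtain ⟨r₀, -, hr₀, hω⟩ := H t ht ht1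
  exact omegaRect_one_eq_of_saturated_le hω (hr₀.trans hr)

end Summit.MatrixMultiplication.MatrixMultiplication.Theorems.SaturationLadderTwinThreshold

end
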